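import Summits.BirchSwinnertonDyer.BirchSwinnertonDyer.Theorems.SylvesterTwoHeegnerIndexCoupledTelescopeLevelDataHalved
import Summits.BirchSwinnertonDyer.BirchSwinnertonDyer.Theorems.SylvesterTwoHeegnerIndexCoupledTelescopeSelmerAwayHalved
import Summits.BirchSwinnertonDyer.BirchSwinnertonDyer.Theorems.SylvesterTwoHeegnerIndexCoupledTelescopeClassSystem
import HarnessLib

/-!
# The COUPLED Cassels–Tate telescope, RESIDUE 7′ (VARIANT Q): the rows' HALVED CLASS SYSTEM `c′_A, c′_B : ℕ → H¹` at the
# level `4^κ` over ALL square-free conductors, `p ≡ 7 (mod 9)` (RESIDUE 7′ (T-L1) class term; crux `UpperOffV0HSYPlus`,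
# stmt-BirchSwinnertonDyer-19804)

Skeleton VARIANT Q `Cruxes/UpperOffV0HSYPlus/Lines/coupled_variantQ.lean` d342db51dc602551, stub `stub_residueSevenHalved`;
planner D762 (3)/D789/D793 (H-E).  The `p ≡ 7 (9)` twin of S4b-1 `exists_classSystem_sylvesterPair` (p739604,
`…CoupledTelescopeClassSystem`): for the display's level `nl = 2^κ·2^κ`, a Kolyvagin-prime predicate `Kol` of (T3-II)'s
shape, and GIVEN global choices (coherent embeddings `emb`, fixers `N`, CM points `y`, coherent generators `σ`; the
pinned frame transport `κ₉`; the coupled frame; the bottom fixer `N₀`) — AND, replacing S4b-1's transversal of `Γ_K/N₀`,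
THE HALF FIXER of CMHalf #S3 `exists_halfFixer` (`N″ ⊇ N₀`, the dichotomy w.r.t. the bottom involution `s`, `N″` fixes
`v_B, v_A`, a family `t` BIJECTIVE onto `Γ_K ⧸ N″`) and THE TOWER FIXING AT EVERY LEVEL (a family `φ n ∈ Aut_K K[9pn]`
restricting to `s`, fixing `y n`, involutive, realised at `w ∋ 3` by some `τ₀ ∈ Γ_{K_w}` — the outputs of #S10c
`SylvesterTwoCMHalf.decompFixing_of_involutionFixing` fed by the registered stub `stub_levelFixingSeven`; displayed as
binders, never restated weaker) — this file DEFINES (inside one ∃, by their defining equations) the HALVED classes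
`c′_A(n) = c(ψ_A(Σᵢ ρ²_{tᵢ}(tᵢ • Pt n)))`, `c′_B(n) = c(ψ_B(Σᵢ ρ_{tᵢ}(tᵢ • Pt n)))` over the HALF transversal
(`n ∈ KolSupp Kol`, `n ≠ 1` on `B`), `Pt n = κ₉⁻¹ ιe_n(D_{l(n)} y_n)`, and `c′_B(1) := 2^{M₀} • x` BY DEFINITION, with their
well-formedness from H-A `levelDataHalved_sylvesterTower` — and discharges the per-class RESIDUE 7′ clauses: l.74
(Kolyvagin primes are inert primes), l.79c (`cB 1 = 2^{M₀} • x`, definitional), l.100–111 (Selmer-away: `A` by (T8)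
`selmerAway_of_recipe_three_mul_sq` verbatim, `B` by H-B `selmerAway_of_recipe_prime_halved` — the place `w ∣ 3` by the
coprime-index criterion from the tower fixing), l.113–120 (the Kolyvagin primes' level, (T5)).  The level-data clause
also exports (R5)″ on `N″` (for the FLIP/SIGNS assemblers).
* ★ `exists_classSystemHalved_sylvesterPair`.
Theorems only (no definition / named fact / instance / notation); CONDITIONAL on the displayed tower-fixing binders;
nothing asserted on 19804; no stub closed on the ledger; X12.CMAtTwo NOT proved; BSD not claimed for any curve.  Sources:
[GrossLMS1991] §3–§4; [McCallumLMS1991] §4 Lemma 4.3; [HuShuYin2019] §2, §4.1; memo g44 §4.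
`lean search 'exists_classSystemHalved'` → nothing before this file.
-/

set_option linter.dupNamespace false -- Summits modules are `Summit.<Summit>.<Problem>…` by design
set_option autoImplicit false

noncomputable section

open scoped Classical Pointwise

namespace Summit.BirchSwinnertonDyer.BirchSwinnertonDyer.Theorems.SylvesterTwoCMFlip

open WeierstrassCurve Field NumberField IsDedekindDomain Finset
open Literature.NumberTheory.EllipticCurves Literature.NumberTheory.GaloisRepresentations
  Literature.NumberTheory.EllipticCurves.ModularForms
  Literature.NumberTheory.EllipticCurves.HuShuYin2019
  Literature.NumberTheory.EllipticCurves.KolyvaginCocycle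
  Literature.NumberTheory.EllipticCurves.KolyvaginDescent
  Literature.NumberTheory.EllipticCurves.RingClassField
  Summit.BirchSwinnertonDyer.BirchSwinnertonDyer.Theorems.SylvesterTwoCMData
  Summit.BirchSwinnertonDyer.BirchSwinnertonDyer.Theorems.SylvesterTwoCMHalf
  Summit.BirchSwinnertonDyer.BirchSwinnertonDyer.Theorems.SylvesterTwoCoupledTelescope
  Summit.BirchSwinnertonDyer.Rank1Residual.X11b
  Summit.BirchSwinnertonDyer.Rank1Residual.X11b.RingClassTower

variable {K : Type} [Field K] [NumberField K]

set_option maxHeartbeats 1600000 in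
/-- ★ **THE HALVED CLASS SYSTEM at the level `4^κ`, `p ≡ 7 (mod 9)`** — existence of `c′_A, c′_B : ℕ → H¹(K, ·[2^κ·2^κ])`
with their DEFINING EQUATIONS over the HALF transversal (through the points `Pt n = κ₉⁻¹ ιe_n (D_{l(n)} y_n)`), `c′_B 1 =
2^{M₀} • x` by definition, and the per-class RESIDUE 7′ clauses l.74, l.100–111, l.113–120; the global choices, the
half fixer and the tower fixing at every level are the caller's (binders).
[cite: GrossLMS1991, §3 (3.3)–(3.7), §4 (4.1)–(4.3), Prop. 6.2 (1)] [cite: McCallumLMS1991, §4 Lemma 4.3]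
[cite: HuShuYin2019, §2 Prop. 2.4, §4.1] -/
theorem exists_classSystemHalved_sylvesterPair {ω : K} (hω : ω ^ 2 + ω + 1 = 0) (h2 : Module.finrank ℚ K = 2)
    (ι : K →+* ℂ) (Dt : ModularParametrizationData (⟨0, 0, 1, 0, -1⟩ : WeierstrassCurve ℚ) 243)
    {p : ℕ} (hp : p.Prime) (h9 : p % 9 = 7) (κ : ℕ) (hκ : 1 ≤ κ)
    -- the Kolyvagin-prime predicate, (T3-II)'s shape
    {NA NB : ℕ} (hNA : 3 * p ∣ NA) (hNAc : (cubeSumCurve (3 * (p : ℚ) ^ 2)).conductorNorm ℤ ∣ NA)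
    (hNBc : (cubeSumCurve (p : ℚ)).conductorNorm ℤ ∣ NB) (b₀ : ℕ) (Kol : ℕ → Prop)
    (hKol : ∀ ℓ, Kol ℓ ↔ (ℓ.Prime ∧ ¬ ℓ ∣ NA ∧ ¬ ℓ ∣ NB ∧ ¬ ((ℓ : ℤ) ∣ NumberField.discr K) ∧ ℓ ≠ 2 ∧
      (Ideal.span {(ℓ : 𝓞 K)}).IsPrime ∧ FrobEqFrobInfty (cubeSumCurve (3 * (p : ℚ) ^ 2)) K (2 ^ κ * 2 ^ κ) ℓ ∧
      FrobEqFrobInfty (cubeSumCurve (p : ℚ)) K (2 ^ κ * 2 ^ κ) ℓ ∧ b₀ < ℓ))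
    -- the bottom class `2^{M₀} • δ x₀`
    (M₀ : ℕ) (x₀ : ((cubeSumCurve (p : ℚ)).baseChange K).toAffine.Point)
    -- global choices: coherent embeddings, point maps, fixers, CM points, coherent generators
    (emb : (m : ℕ) → (ringClassField K ι m →+* AlgebraicClosure K))
    (hemb : ∀ (m : ℕ) (k : K), emb m (algebraMap K (ringClassField K ι m) k) = algebraMap K (AlgebraicClosure K) k)
    (hcoh : ∀ (m n : ℕ) (h : ringClassField K ι m ≤ ringClassField K ι n) (x : ringClassField K ι m),
      emb n (RingClassField.inclusion ι h x) = emb m x)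
    (ιe : (n : ℕ) → (letI : DecidableEq (ringClassField K ι (9 * p * n)) := fun a b ↦ Classical.propDecidable (a = b)
      ((⟨0, 0, 1, 0, -1⟩ : WeierstrassCurve ℚ).baseChange (ringClassField K ι (9 * p * n))).toAffine.Point →+
        geomPoints ((⟨0, 0, 1, 0, -1⟩ : WeierstrassCurve ℚ).baseChange K)))
    (hιe : ∀ n P, ιe n P = Affine.Point.map (W' := (⟨0, 0, 1, 0, -1⟩ : WeierstrassCurve ℚ)) (emb (9 * p * n)).toRatAlgHom P)
    (Nf : ℕ → Subgroup (absoluteGaloisGroup K))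
    (hNf : ∀ (m : ℕ) (g : absoluteGaloisGroup K), g ∈ Nf m ↔
      ∀ x : ringClassField K ι m, (show AlgebraicClosure K ≃ₐ[K] AlgebraicClosure K from g) (emb m x) = emb m x)
    (y : (n : ℕ) → ((⟨0, 0, 1, 0, -1⟩ : WeierstrassCurve ℚ).baseChange (ringClassField K ι (9 * p * n))).toAffine.Point)
    (hy : ∀ n, n ≠ 0 → (∀ q ∈ n.primeFactors, q % 3 = 2) →
      Affine.Point.map (W' := (⟨0, 0, 1, 0, -1⟩ : WeierstrassCurve ℚ)) (ringClassField K ι (9 * p * n)).subtype.toRatAlgHom (y n) =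
        Dt.φ (heegnerTau ((n : ℤ) ^ 2 * (81 * ((p : ℤ) ^ 2 + 4 * p + 16)),
          (n : ℤ) * (-(9 * (4 * (p : ℤ) ^ 2 + 17 * p + 72))), 4 * (p : ℤ) ^ 2 + 18 * p + 81)))
    (σ : (n q : ℕ) → (ringClassField K ι (9 * p * n) ≃ₐ[ℚ] ringClassField K ι (9 * p * n)))
    (hσgen : ∀ n q, n ≠ 0 → q.Prime → ¬ q ∣ 9 * p → (Ideal.span {(q : 𝓞 K)}).IsPrime → q ∣ n → ¬ q ∣ n / q →
      Subgroup.zpowers (σ n q) = ringClassGalOver ι (9 * p * n) (9 * p * n / q))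
    -- the frame transport `E₉(K̄) ≃+ W₀(K̄)` and the coupled frame (`exists_coupledFrame`)
    (κ₉ : geomPoints ((cubeSumCurve 9).baseChange K) ≃+ geomPoints ((⟨0, 0, 1, 0, -1⟩ : WeierstrassCurve ℚ).baseChange K))
    (hκG : ∀ (g : absoluteGaloisGroup K) (P : geomPoints ((cubeSumCurve 9).baseChange K)), κ₉ (g • P) = g • κ₉ P)
    {vB vA : AlgebraicClosure K} (hvBc : vB ^ 3 = algebraMap ℚ (AlgebraicClosure K) ((p : ℚ) / 9))
    (hvB : vB ≠ 0) (hvAc : vA ^ 3 = algebraMap ℚ (AlgebraicClosure K) ((p : ℚ) ^ 2 / 3)) (hvA0 : vA ≠ 0)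
    (hvB3 : ∀ g : absoluteGaloisGroup K, ((show AlgebraicClosure K ≃ₐ[K] AlgebraicClosure K from g) vB) ^ 3 = vB ^ 3)
    (hvA3 : ∀ g : absoluteGaloisGroup K, ((show AlgebraicClosure K ≃ₐ[K] AlgebraicClosure K from g) vA) ^ 3 = vA ^ 3)
    {ψB : geomPoints ((cubeSumCurve 9).baseChange K) ≃+ geomPoints ((cubeSumCurve (p : ℚ)).baseChange K)}
    {ψA : geomPoints ((cubeSumCurve 9).baseChange K) ≃+ geomPoints ((cubeSumCurve (3 * (p : ℚ) ^ 2)).baseChange K)}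
    (hψB : ∀ {x y : AlgebraicClosure K}
      (h : (((cubeSumCurve 9).baseChange K).baseChange (AlgebraicClosure K)).toAffine.Nonsingular x y),
      ∃ h', ψB (Affine.Point.some x y h) = Affine.Point.some (vB ^ 2 * x) (vB ^ 3 * y) h')
    (hψA : ∀ {x y : AlgebraicClosure K}
      (h : (((cubeSumCurve 9).baseChange K).baseChange (AlgebraicClosure K)).toAffine.Nonsingular x y),
      ∃ h', ψA (Affine.Point.some x y h) = Affine.Point.some (vA ^ 2 * x) (vA ^ 3 * y) h')
    {ρ : absoluteGaloisGroup K → geomPoints ((cubeSumCurve 9).baseChange K) ≃+ geomPoints ((cubeSumCurve 9).baseChange K)}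
    (hρ : ∀ (g : absoluteGaloisGroup K) {x y : AlgebraicClosure K}
        (h : (((cubeSumCurve 9).baseChange K).baseChange (AlgebraicClosure K)).toAffine.Nonsingular x y),
        ∃ h', ρ g (Affine.Point.some x y h) =
          Affine.Point.some (((show AlgebraicClosure K ≃ₐ[K] AlgebraicClosure K from g) vB / vB) ^ 2 * x) y h')
    (hρρ : ∀ (g : absoluteGaloisGroup K) {x y : AlgebraicClosure K}
        (h : (((cubeSumCurve 9).baseChange K).baseChange (AlgebraicClosure K)).toAffine.Nonsingular x y),
        ∃ h', ρ g (ρ g (Affine.Point.some x y h)) =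
          Affine.Point.some (((show AlgebraicClosure K ≃ₐ[K] AlgebraicClosure K from g) vA / vA) ^ 2 * x) y h')
    (hlawB : ∀ (g : absoluteGaloisGroup K) (P : geomPoints ((cubeSumCurve 9).baseChange K)), g • ψB P = ψB (ρ g (g • P)))
    (hlawA : ∀ (g : absoluteGaloisGroup K) (P : geomPoints ((cubeSumCurve 9).baseChange K)),
        g • ψA P = ψA (ρ g (ρ g (g • P))))
    -- the bottom fixer and transversal (`exists_bottom_transversal` at `emb (9 * p)`)
    (N₀ : Subgroup (absoluteGaloisGroup K))
    (hN₀ : ∀ g : absoluteGaloisGroup K, g ∈ N₀ ↔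
      ∀ x : ringClassField K ι (9 * p), (show AlgebraicClosure K ≃ₐ[K] AlgebraicClosure K from g) (emb (9 * p) x) = emb (9 * p) x)
    -- THE HALF FIXER (`exists_halfFixer`): the bottom involution `s` (fixing `∛3, ∛p`), `N″ ⊇ N₀` with the dichotomy,
    -- `N″` fixes `v_B, v_A`, and a HALF transversal `t` — representatives of `Γ_K ⧸ N″`
    (s : ringClassField K ι (9 * p) ≃ₐ[K] ringClassField K ι (9 * p)) (hs1 : s ≠ 1) (hs2 : s * s = 1)
    {c₃ cp : ringClassField K ι (9 * p)} (hc₃ : c₃ ^ 3 = 3) (hcp : cp ^ 3 = (p : ringClassField K ι (9 * p)))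
    (hs3 : s c₃ = c₃) (hsp : s cp = cp)
    (N'' : Subgroup (absoluteGaloisGroup K)) (hN''₀ : ∀ g ∈ N₀, g ∈ N'')
    (hdich : ∀ g ∈ N'', (∀ x : ringClassField K ι (9 * p),
        (show AlgebraicClosure K ≃ₐ[K] AlgebraicClosure K from g) (emb (9 * p) x) = emb (9 * p) x) ∨
      (∀ x : ringClassField K ι (9 * p),
        (show AlgebraicClosure K ≃ₐ[K] AlgebraicClosure K from g) (emb (9 * p) x) = emb (9 * p) (s x)))
    (hN''vB : ∀ g ∈ N'', (show AlgebraicClosure K ≃ₐ[K] AlgebraicClosure K from g) vB = vB)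
    (hN''vA : ∀ g ∈ N'', (show AlgebraicClosure K ≃ₐ[K] AlgebraicClosure K from g) vA = vA)
    {ιt : Type} [Fintype ιt] (t : ιt → absoluteGaloisGroup K)
    (ht : Function.Bijective fun i ↦ (t i : absoluteGaloisGroup K ⧸ N''))
    -- THE TOWER FIXING AT EVERY LEVEL (W2-b via #S10c; displayed, not proved): `φ n` restricts to `s`, fixes `y n`,
    -- is an involution, and is realised at the place `w ∋ 3` by some `τ₀ ∈ Γ_{K_w}`
    (φ : (n : ℕ) → (ringClassField K ι (9 * p * n) ≃ₐ[K] ringClassField K ι (9 * p * n)))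
    (hφs : ∀ n, n ≠ 0 → (∀ q ∈ n.primeFactors, q % 3 = 2) →
      ∀ (hle : ringClassField K ι (9 * p) ≤ ringClassField K ι (9 * p * n)) (x : ringClassField K ι (9 * p)),
        φ n (RingClassField.inclusion ι hle x) = RingClassField.inclusion ι hle (s x))
    (hφy : ∀ n, n ≠ 0 → (∀ q ∈ n.primeFactors, q % 3 = 2) →
      pointGalHom (⟨0, 0, 1, 0, -1⟩ : WeierstrassCurve ℚ) (ringClassField K ι (9 * p * n)) ((φ n).restrictScalars ℚ) (y n) = y n)
    (hφ2 : ∀ n, n ≠ 0 → (∀ q ∈ n.primeFactors, q % 3 = 2) → φ n * φ n = 1)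
    (hφτ : ∀ n, n ≠ 0 → (∀ q ∈ n.primeFactors, q % 3 = 2) →
      ∀ w : HeightOneSpectrum (𝓞 K), ((3 : ℕ) : 𝓞 K) ∈ w.asIdeal →
        ∃ τ₀ : absoluteGaloisGroup (w.adicCompletion K), ∀ x : ringClassField K ι (9 * p * n),
          (show AlgebraicClosure K ≃ₐ[K] AlgebraicClosure K from resGal (K := K) (w.adicCompletion K) τ₀) (emb (9 * p * n) x) =
            emb (9 * p * n) (φ n x)) :
    ∃ (Pt : ℕ → geomPoints ((cubeSumCurve 9).baseChange K))
      (cA : ℕ → galH1Torsion ((cubeSumCurve (3 * (p : ℚ) ^ 2)).baseChange K) ((2 ^ κ * 2 ^ κ : ℕ) : ℤ))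
      (cB : ℕ → galH1Torsion ((cubeSumCurve (p : ℚ)).baseChange K) ((2 ^ κ * 2 ^ κ : ℕ) : ℤ)),
      -- the derived points
      (∀ n, Pt n = κ₉.symm (ιe n (((n.primeFactors.sort (· ≤ ·)).map fun q ↦ (σ n q, q)).foldr
        (fun b z ↦ KolyvaginOperator.derivOp (pointGalHom (⟨0, 0, 1, 0, -1⟩ : WeierstrassCurve ℚ) (ringClassField K ι (9 * p * n))) b.1 b.2 z) (y n)))) ∧
      -- the level data at every `n ∈ KolSupp Kol`
      (∀ n, KolSupp Kol n → Pt n ∈ FixedPoints.addSubgroup (Nf (9 * p * n)) (geomPoints ((cubeSumCurve 9).baseChange K)) ∧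
        (Nf (9 * p * n)).Normal ∧ (∀ h ∈ Nf (9 * p * n), (show AlgebraicClosure K ≃ₐ[K] AlgebraicClosure K from h) vB = vB) ∧
        (∀ h ∈ N₀, ∃ a ∈ FixedPoints.addSubgroup (Nf (9 * p * n)) (geomPoints ((cubeSumCurve 9).baseChange K)),
          ((2 ^ κ * 2 ^ κ : ℕ) : ℤ) • a = h • Pt n - Pt n) ∧
        (∀ h ∈ N'', ∃ a ∈ FixedPoints.addSubgroup (Nf (9 * p * n)) (geomPoints ((cubeSumCurve 9).baseChange K)),
          ((2 ^ κ * 2 ^ κ : ℕ) : ℤ) • a = h • Pt n - Pt n)) ∧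
      -- the defining equations of the classes
      (∀ n, KolSupp Kol n → ∃ (hA : IsAdmissible (absoluteGaloisGroup K)
          ((FixedPoints.addSubgroup (Nf (9 * p * n)) (geomPoints ((cubeSumCurve 9).baseChange K))).map ψA.toAddMonoidHom) ((2 ^ κ * 2 ^ κ : ℕ) : ℤ))
        (hP : ψA (∑ i, ρ (t i) (ρ (t i) (t i • Pt n))) ∈ invPoints (absoluteGaloisGroup K)
          ((FixedPoints.addSubgroup (Nf (9 * p * n)) (geomPoints ((cubeSumCurve 9).baseChange K))).map ψA.toAddMonoidHom) ((2 ^ κ * 2 ^ κ : ℕ) : ℤ)),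
        cA n = kolyvaginClass ((cubeSumCurve (3 * (p : ℚ) ^ 2)).baseChange K) ((2 ^ κ * 2 ^ κ : ℕ) : ℤ)
          (((cubeSumCurve (3 * (p : ℚ) ^ 2)).baseChange K).zsmul_geomPoints_surjective_of_charZero
            (Int.natCast_ne_zero.mpr (mul_ne_zero (pow_ne_zero κ two_ne_zero) (pow_ne_zero κ two_ne_zero))))
          hA (ψA (∑ i, ρ (t i) (ρ (t i) (t i • Pt n)))) hP) ∧
      (∀ n, KolSupp Kol n → n ≠ 1 → ∃ (hA : IsAdmissible (absoluteGaloisGroup K)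
          ((FixedPoints.addSubgroup (Nf (9 * p * n)) (geomPoints ((cubeSumCurve 9).baseChange K))).map ψB.toAddMonoidHom) ((2 ^ κ * 2 ^ κ : ℕ) : ℤ))
        (hP : ψB (∑ i, ρ (t i) (t i • Pt n)) ∈ invPoints (absoluteGaloisGroup K)
          ((FixedPoints.addSubgroup (Nf (9 * p * n)) (geomPoints ((cubeSumCurve 9).baseChange K))).map ψB.toAddMonoidHom) ((2 ^ κ * 2 ^ κ : ℕ) : ℤ)),
        cB n = kolyvaginClass ((cubeSumCurve (p : ℚ)).baseChange K) ((2 ^ κ * 2 ^ κ : ℕ) : ℤ)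
          (((cubeSumCurve (p : ℚ)).baseChange K).zsmul_geomPoints_surjective_of_charZero
            (Int.natCast_ne_zero.mpr (mul_ne_zero (pow_ne_zero κ two_ne_zero) (pow_ne_zero κ two_ne_zero))))
          hA (ψB (∑ i, ρ (t i) (t i • Pt n))) hP) ∧
      -- l.79c
      cB 1 = ((2 : ℤ) ^ M₀) • kummerMapTorsion ((cubeSumCurve (p : ℚ)).baseChange K) ((2 ^ κ * 2 ^ κ : ℕ) : ℤ)
        (((cubeSumCurve (p : ℚ)).baseChange K).zsmul_geomPoints_surjective_of_charZero
          (Int.natCast_ne_zero.mpr (mul_ne_zero (pow_ne_zero κ two_ne_zero) (pow_ne_zero κ two_ne_zero)))) x₀ ∧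
      -- l.74
      (∀ ℓ, Kol ℓ → ℓ.Prime ∧ (Ideal.span {(ℓ : 𝓞 K)}).IsPrime) ∧
      -- l.100–111 (Selmer away from `λ` and the places over `m`)
      (∀ ℓ m : ℕ, Kol ℓ → KolSupp Kol (ℓ * m) → ¬ ℓ ∣ m →
        ∀ v₀ : HeightOneSpectrum (𝓞 K), (ℓ : 𝓞 K) ∈ v₀.asIdeal →
        ∀ v : Place K, v ≠ Sum.inr v₀ →
          (∀ q : HeightOneSpectrum (𝓞 K), (∃ r ∈ m.primeFactors, (r : 𝓞 K) ∈ q.asIdeal) → v ≠ Sum.inr q) →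
          cA (ℓ * m) ∈ selmerLocalKer ((cubeSumCurve (3 * (p : ℚ) ^ 2)).baseChange K) (Place.Completion v) ((2 ^ κ * 2 ^ κ : ℕ) : ℤ)) ∧
      (∀ ℓ m : ℕ, Kol ℓ → KolSupp Kol (ℓ * m) → ¬ ℓ ∣ m →
        ∀ v₀ : HeightOneSpectrum (𝓞 K), (ℓ : 𝓞 K) ∈ v₀.asIdeal →
        ∀ v : Place K, v ≠ Sum.inr v₀ →
          (∀ q : HeightOneSpectrum (𝓞 K), (∃ r ∈ m.primeFactors, (r : 𝓞 K) ∈ q.asIdeal) → v ≠ Sum.inr q) →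
          cB (ℓ * m) ∈ selmerLocalKer ((cubeSumCurve (p : ℚ)).baseChange K) (Place.Completion v) ((2 ^ κ * 2 ^ κ : ℕ) : ℤ)) ∧
      -- l.113–120 (the Kolyvagin primes' level)
      (∀ r : ℕ, Kol r → ∀ q : HeightOneSpectrum (𝓞 K), (r : 𝓞 K) ∈ q.asIdeal →
        ∀ (g : absoluteGaloisGroup (Place.Completion (Sum.inr q : Place K)))
          (Q : geomTorsion ((cubeSumCurve (3 * (p : ℚ) ^ 2)).baseChange K) ((2 ^ κ * 2 ^ κ : ℕ) : ℤ)),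
          absGaloisRestrict K (Place.Completion (Sum.inr q : Place K)) g • Q = Q) ∧
      (∀ r : ℕ, Kol r → ∀ q : HeightOneSpectrum (𝓞 K), (r : 𝓞 K) ∈ q.asIdeal →
        ∀ (g : absoluteGaloisGroup (Place.Completion (Sum.inr q : Place K)))
          (Q : geomTorsion ((cubeSumCurve (p : ℚ)).baseChange K) ((2 ^ κ * 2 ^ κ : ℕ) : ℤ)),
          absGaloisRestrict K (Place.Completion (Sum.inr q : Place K)) g • Q = Q) := by
  have hK := JZero.isImaginaryQuadratic_of_sq_add_self_add_one hω h2
  have hp3 : p % 3 = 1 := by omega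
  have hp0 : p ≠ 0 := hp.ne_zero
  have hp0' : (p : ℚ) ≠ 0 := by exact_mod_cast hp0
  have hp2 : p ≠ 2 := by rintro rfl; norm_num at h9
  have hp3ne : p ≠ 3 := by rintro rfl; norm_num at h9
  have hdK := JZero.discr_eq_neg_three_of_sq_add_self_add_one hω h2
  have h9p : 9 * p ≠ 0 := mul_ne_zero (by norm_num) hp0
  haveI := isElliptic_sylvesterNineMinimal
  haveI := isGloballyMinimal_sylvesterNineMinimal
  haveI hBellQ : (cubeSumCurve (p : ℚ)).IsElliptic := by
    have h := isElliptic_cubeSumCurve_baseChange ℚ hp0'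
    rwa [WeierstrassCurve.baseChange, Algebra.algebraMap_self, WeierstrassCurve.map_id] at h
  have hlev : 2 ^ κ * 2 ^ κ = 2 ^ (2 * κ) := by rw [two_mul, pow_add]
  -- ### what `Kol q` gives for a prime `q`
  have hKolq : ∀ q, Kol q → q.Prime ∧ q % 3 = 2 ∧ q ≠ 2 ∧ ¬ q ∣ 9 * p ∧ (Ideal.span {(q : 𝓞 K)}).IsPrime ∧
      2 ^ (2 * κ) ∣ q + 1 := by
    intro q hq
    obtain ⟨hqp, hqA, hqB, hqd, hq2, hqP, -, hFB, -⟩ := (hKol q).mp hq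
    have hFB2 : FrobEqFrobInfty (cubeSumCurve (p : ℚ)) K 2 q :=
      FrobEqFrobInfty.of_dvd (W := cubeSumCurve (p : ℚ)) (K := K) ((dvd_pow_self 2 (by omega : κ ≠ 0)).mul_right _) hFB
    obtain ⟨hq3, hqp'⟩ := mod_three_eq_two_of_clause hω h2 hp hp3 hqp hqd hFB2
    have hq9p : ¬ q ∣ 9 * p := fun h ↦ by
      rcases (Nat.Prime.dvd_mul hqp).mp h with h9 | h'
      · have : q ∣ 3 := hqp.dvd_of_dvd_pow (by norm_num at h9 ⊢; exact h9 : q ∣ 3 ^ 2)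
        have := (Nat.prime_dvd_prime_iff_eq hqp Nat.prime_three).mp this
        omega
      · exact hqp' h'
    have hkol : IsKolyvaginPrime NB (cubeSumCurve (p : ℚ)) K 2 q :=
      ⟨hqp, hqB, hqd, hq2, hqP, hFB2⟩
    have hdvd := (IsKolyvaginPrime.pow_dvd_add_one (cubeSumCurve (p : ℚ)) Nat.prime_two hkol (M := 2 * κ) (by omega) (hlev ▸ hFB)).1
    exact ⟨hqp, hq3, hq2, hq9p, hqP, Int.natCast_dvd_natCast.mp (by exact_mod_cast hdvd)⟩
  -- ### the lists of generators and their properties at `n ∈ KolSupp Kol`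
  have hlist : ∀ n, KolSupp Kol n →
      (∀ a ∈ ((n.primeFactors.sort (· ≤ ·)).map fun q ↦ (σ n q, q)), a.2 ∈ n.primeFactors) ∧
      (∀ q ∈ n.primeFactors, ∃ a ∈ ((n.primeFactors.sort (· ≤ ·)).map fun q ↦ (σ n q, q)), a.2 = q) ∧
      (∀ a ∈ ((n.primeFactors.sort (· ≤ ·)).map fun q ↦ (σ n q, q)), a.2 % 3 = 2) ∧
      (∀ a ∈ ((n.primeFactors.sort (· ≤ ·)).map fun q ↦ (σ n q, q)), a.2 ≠ 2) ∧
      (∀ a ∈ ((n.primeFactors.sort (· ≤ ·)).map fun q ↦ (σ n q, q)),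
        Subgroup.zpowers a.1 = ringClassGalOver ι (9 * p * n) (9 * p * n / a.2)) ∧
      (∀ a ∈ ((n.primeFactors.sort (· ≤ ·)).map fun q ↦ (σ n q, q)), 2 ^ (2 * κ) ∣ a.2 + 1) := by
    rintro n ⟨hsq, hkol⟩
    have hmem : ∀ a ∈ ((n.primeFactors.sort (· ≤ ·)).map fun q ↦ (σ n q, q)), a.2 ∈ n.primeFactors ∧ a = (σ n a.2, a.2) := by
      intro a ha
      obtain ⟨q, hq, rfl⟩ := List.mem_map.mp ha
      exact ⟨(Finset.mem_sort _).mp hq, rfl⟩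
    refine ⟨fun a ha ↦ (hmem a ha).1, fun q hq ↦ ⟨(σ n q, q), List.mem_map.mpr ⟨q, (Finset.mem_sort _).mpr hq, rfl⟩, rfl⟩,
      fun a ha ↦ (hKolq _ (hkol _ (hmem a ha).1)).2.1, fun a ha ↦ (hKolq _ (hkol _ (hmem a ha).1)).2.2.1,
      fun a ha ↦ ?_, fun a ha ↦ (hKolq _ (hkol _ (hmem a ha).1)).2.2.2.2.2⟩
    obtain ⟨hq, e⟩ := hmem a ha
    obtain ⟨hqp, -, -, hq9p, hqP, -⟩ := hKolq _ (hkol _ hq)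
    have hqn : a.2 ∣ n := Nat.dvd_of_mem_primeFactors hq
    have hqn' : ¬ a.2 ∣ n / a.2 := fun h' ↦
      hqp.one_lt.ne' (Nat.isUnit_iff.mp (hsq _ (Nat.mul_dvd_of_dvd_div hqn h')))
    rw [e]
    exact hσgen n a.2 hsq.ne_zero hqp hq9p hqP hqn hqn'
  -- ### the level data at every `n ∈ KolSupp Kol`
  -- the prime factors of `n ∈ KolSupp Kol` are `≡ 2 (3)`
  have hq3 : ∀ n, KolSupp Kol n → ∀ q ∈ n.primeFactors, q % 3 = 2 := fun n h q hq ↦ (hKolq q (h.2 q hq)).2.1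
  have LD := fun n (h : KolSupp Kol n) ↦
    levelDataHalved_sylvesterTower hω h2 ι Dt hp hp3 h.1 (rfl : 9 * p * n = 9 * p * n) κ₉ hκG hvBc hvB hvAc hvA0 hvB3 hvA3
      hρ hρρ hlawB hlawA (emb (9 * p)) (hemb _) N₀ hN₀ s hs2 N'' hN''₀ hdich hN''vB hN''vA t ht
      (ringClassField_mono hK ι (dvd_mul_right (9 * p) n) (mul_ne_zero h9p h.1.ne_zero)) (emb (9 * p * n)) (hemb _)
      (fun x ↦ hcoh _ _ _ x) (ιe n) (hιe n) (Nf (9 * p * n)) (hNf _) _ (hlist n h).1 (hlist n h).2.1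
      (hlist n h).2.2.1 (hlist n h).2.2.2.1 (hlist n h).2.2.2.2.1 (2 ^ κ * 2 ^ κ) hlev (hlist n h).2.2.2.2.2
      (hy n h.1.ne_zero (hq3 n h)) (φ n) (hφs n h.1.ne_zero (hq3 n h) _) (hφy n h.1.ne_zero (hq3 n h))
  -- ### the classes
  refine ⟨fun n ↦ κ₉.symm (ιe n (((n.primeFactors.sort (· ≤ ·)).map fun q ↦ (σ n q, q)).foldr
      (fun b z ↦ KolyvaginOperator.derivOp (pointGalHom (⟨0, 0, 1, 0, -1⟩ : WeierstrassCurve ℚ) (ringClassField K ι (9 * p * n))) b.1 b.2 z) (y n))),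
    fun n ↦ if h : KolSupp Kol n then
      kolyvaginClass ((cubeSumCurve (3 * (p : ℚ) ^ 2)).baseChange K) ((2 ^ κ * 2 ^ κ : ℕ) : ℤ)
        (((cubeSumCurve (3 * (p : ℚ) ^ 2)).baseChange K).zsmul_geomPoints_surjective_of_charZero
          (Int.natCast_ne_zero.mpr (mul_ne_zero (pow_ne_zero κ two_ne_zero) (pow_ne_zero κ two_ne_zero)))) (LD n h).2.2.2.2.2.2.2.2.2.2.1 _
        (LD n h).2.2.2.2.2.2.2.2.2.2.2.2.2 else 0,
    fun n ↦ if h1 : n = 1 then ((2 : ℤ) ^ M₀) • kummerMapTorsion ((cubeSumCurve (p : ℚ)).baseChange K) ((2 ^ κ * 2 ^ κ : ℕ) : ℤ)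
        (((cubeSumCurve (p : ℚ)).baseChange K).zsmul_geomPoints_surjective_of_charZero
          (Int.natCast_ne_zero.mpr (mul_ne_zero (pow_ne_zero κ two_ne_zero) (pow_ne_zero κ two_ne_zero)))) x₀
      else if h : KolSupp Kol n then
      kolyvaginClass ((cubeSumCurve (p : ℚ)).baseChange K) ((2 ^ κ * 2 ^ κ : ℕ) : ℤ)
        (((cubeSumCurve (p : ℚ)).baseChange K).zsmul_geomPoints_surjective_of_charZero
          (Int.natCast_ne_zero.mpr (mul_ne_zero (pow_ne_zero κ two_ne_zero) (pow_ne_zero κ two_ne_zero)))) (LD n h).2.2.2.2.2.2.2.2.2.1 _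
        (LD n h).2.2.2.2.2.2.2.2.2.2.2.2.1 else 0,
    fun n ↦ rfl, fun n h ↦ ⟨(LD n h).2.2.2.1, (LD n h).2.2.2.2.2.1, (LD n h).2.2.2.2.2.2.2.2.1, (LD n h).2.2.2.2.1,
      (LD n h).2.2.2.2.2.2.2.2.2.2.2.1⟩,
    fun n h ↦ ⟨(LD n h).2.2.2.2.2.2.2.2.2.2.1, (LD n h).2.2.2.2.2.2.2.2.2.2.2.2.2, by simp only [dif_pos h]⟩,
    fun n h h1 ↦ ⟨(LD n h).2.2.2.2.2.2.2.2.2.1, (LD n h).2.2.2.2.2.2.2.2.2.2.2.2.1, by simp only [dif_neg h1, dif_pos h]⟩,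
    dif_pos rfl, fun ℓ hℓ ↦ ⟨(hKolq ℓ hℓ).1, (hKolq ℓ hℓ).2.2.2.2.1⟩, ?_, ?_, ?_, ?_⟩
  · -- Selmer-away for `c_A(ℓm)` ((T8) at the conductor `9p(ℓm)`)
    intro ℓ m hℓ hℓm hℓm' v₀ hv₀ v hv hvq
    have h := hℓm
    simp only [dif_pos h]
    obtain ⟨hℓp, -, -, -, hℓP, -⟩ := hKolq ℓ hℓ
    haveI : (Nf (9 * p * (ℓ * m))).Normal := (LD _ h).2.2.2.2.2.1
    have hQN := chiComponent_mem (fun g ↦ ((ρ g).trans (ρ g)).toAddMonoidHom)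
      (fun g _ ha ↦ JZero.smul_mem_fixedPoints _ (Nf (9 * p * (ℓ * m))) g ha)
      (fun g _ ha ↦ JZero.rho_mem_fixedPoints _ hω hvB hvB3 hρ (Nf (9 * p * (ℓ * m))) g
        (JZero.rho_mem_fixedPoints _ hω hvB hvB3 hρ (Nf (9 * p * (ℓ * m))) g ha)) t (LD _ h).2.2.2.1
    have hNle : Nf (9 * p * (ℓ * m)) ≤ N₀ := fun g hg ↦ (hN₀ g).mpr fun x ↦ by
      rw [← hcoh _ _ (ringClassField_mono hK ι (dvd_mul_right (9 * p) (ℓ * m)) (mul_ne_zero h9p h.1.ne_zero)) x]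
      exact (hNf _ g).mp hg _
    refine selmerAway_of_recipe_three_mul_sq hω h2 hp hp2 hp3ne (2 ^ κ * 2 ^ κ) hlev h.1.ne_zero ι (emb _) (hemb _)
      (Nf _) (hNf _) hψA (fun g hg ↦ (LD _ h).2.2.2.2.2.2.2.1 g (hNle hg)) (LD _ h).2.2.2.2.2.2.2.2.2.2.1 hQN
      (LD _ h).2.2.2.2.2.2.2.2.2.2.2.2.2 v fun q ⟨r, hr, hrq⟩ ↦ ?_
    rw [Nat.primeFactors_mul hℓp.ne_zero (fun hm ↦ h.1.ne_zero (by rw [hm, mul_zero])), Finset.mem_union,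
      hℓp.primeFactors, Finset.mem_singleton] at hr
    rcases hr with rfl | hr
    · have hq : q = v₀ := HeightOneSpectrum.ext (by rw [asIdeal_eq_span_of_mem hℓp hℓP hrq, asIdeal_eq_span_of_mem hℓp hℓP hv₀])
      rw [hq]; exact hv
    · exact hvq q ⟨r, hr, hrq⟩
  · -- Selmer-away for `c_B(ℓm)`
    intro ℓ m hℓ hℓm hℓm' v₀ hv₀ v hv hvq
    have h := hℓm
    obtain ⟨hℓp, -, -, -, hℓP, -⟩ := hKolq ℓ hℓ
    have h1 : ℓ * m ≠ 1 := fun e ↦ hℓp.one_lt.ne' (Nat.eq_one_of_mul_eq_one_right e)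
    simp only [dif_neg h1, dif_pos h]
    haveI : (Nf (9 * p * (ℓ * m))).Normal := (LD _ h).2.2.2.2.2.1
    have hQN := chiComponent_mem (fun g ↦ (ρ g).toAddMonoidHom)
      (fun g _ ha ↦ JZero.smul_mem_fixedPoints _ (Nf (9 * p * (ℓ * m))) g ha)
      (fun g _ ha ↦ JZero.rho_mem_fixedPoints _ hω hvB hvB3 hρ (Nf (9 * p * (ℓ * m))) g ha) t (LD _ h).2.2.2.1
    -- THE TOWER FIXING at the level `9p(ℓm)`: `φ (ℓm) ≠ 1`, cube roots, and a lift `φ̃` FIXING `Pt (ℓm)`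
    have hn0 : ℓ * m ≠ 0 := h.1.ne_zero
    have hn3 : ¬ 3 ∣ ℓ * m := fun h3 ↦ by
      have := hq3 _ h 3 (Nat.mem_primeFactors.mpr ⟨Nat.prime_three, h3, hn0⟩); omega
    have hle : ringClassField K ι (9 * p) ≤ ringClassField K ι (9 * p * (ℓ * m)) :=
      ringClassField_mono hK ι (dvd_mul_right (9 * p) (ℓ * m)) (mul_ne_zero h9p hn0)
    have hφ1 : φ (ℓ * m) ≠ 1 := by
      intro h1'
      apply hs1
      refine AlgEquiv.ext fun x ↦ ?_
      have hx := hφs (ℓ * m) hn0 (hq3 _ h) hle x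
      rw [h1', AlgEquiv.one_apply] at hx
      rw [AlgEquiv.one_apply]
      exact ((RingClassField.inclusion ι hle).injective hx).symm
    have hc₃' : (RingClassField.inclusion ι hle c₃) ^ 3 = 3 := by rw [← map_pow, hc₃, map_ofNat]
    have hcp' : (RingClassField.inclusion ι hle cp) ^ 3 = (p : ringClassField K ι (9 * p * (ℓ * m))) := by
      rw [← map_pow, hcp, map_natCast]
    have hφ3 : φ (ℓ * m) (RingClassField.inclusion ι hle c₃) = RingClassField.inclusion ι hle c₃ := by
      rw [hφs (ℓ * m) hn0 (hq3 _ h) hle, hs3]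
    have hφp : φ (ℓ * m) (RingClassField.inclusion ι hle cp) = RingClassField.inclusion ι hle cp := by
      rw [hφs (ℓ * m) hn0 (hq3 _ h) hle, hsp]
    haveI := (finiteDimensional_and_isGalois_ringClassField hK ι (mul_ne_zero h9p hn0)).1
    haveI := (finiteDimensional_and_isGalois_ringClassField hK ι (mul_ne_zero h9p hn0)).2
    obtain ⟨φt, hφt⟩ := exists_lift_algEquiv (emb (9 * p * (ℓ * m))) (hemb _) (φ (ℓ * m))
    have hcommφ : ∀ a ∈ ((((ℓ * m).primeFactors.sort (· ≤ ·)).map fun q ↦ (σ (ℓ * m) q, q))),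
        Commute ((φ (ℓ * m)).restrictScalars ℚ) a.1 := by
      intro a ha
      have hφG : (φ (ℓ * m)).restrictScalars ℚ ∈ ringClassGal ι (9 * p * (ℓ * m)) :=
        (mem_ringClassGal_iff_forall_apply_algebraMap ι _ _).mpr fun k ↦ (φ (ℓ * m)).commutes k
      have haG : a.1 ∈ ringClassGal ι (9 * p * (ℓ * m)) :=
        ringClassGalOver_le_ringClassGal ι _ _ (((hlist _ h).2.2.2.2.1 a ha) ▸ Subgroup.mem_zpowers a.1)
      have hc := (KolyvaginH44.isMulCommutative_ringClassGal' hK ι (9 * p * (ℓ * m))).is_comm.comm ⟨_, hφG⟩ ⟨_, haG⟩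
      exact congrArg Subtype.val hc
    have hfin := pointGalHom_foldr_derivOp_comm (⟨0, 0, 1, 0, -1⟩ : WeierstrassCurve ℚ)
      ((((ℓ * m).primeFactors.sort (· ≤ ·)).map fun q ↦ (σ (ℓ * m) q, q))) hcommφ (y (ℓ * m))
    rw [hφy (ℓ * m) hn0 (hq3 _ h)] at hfin
    have hφP := smul_symm_embPoints_eq_of_apply_eq (emb (9 * p * (ℓ * m))) κ₉ hκG (ιe (ℓ * m)) (hιe _)
      ((φ (ℓ * m)).restrictScalars ℚ) hφt hfin
    refine selmerAway_of_recipe_prime_halved hω h2 hp hp3 (2 ^ κ * 2 ^ κ) hlev hn0 hn3 ι (emb _) (hemb _)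
      (Nf _) (hNf _) hvBc hvB hvB3 hψB hρ (LD _ h).2.2.2.2.2.2.2.2.1 t (LD _ h).2.2.2.2.2.2.2.2.2.1 (LD _ h).2.2.2.1 hQN
      (LD _ h).2.2.2.2.2.2.2.2.2.2.2.2.1 hc₃' hcp' (φ (ℓ * m)) hφ1 (hφ2 (ℓ * m) hn0 (hq3 _ h)) hφ3 hφp
      (hφτ (ℓ * m) hn0 (hq3 _ h)) hφt hφP v fun q ⟨r, hr, hrq⟩ ↦ ?_
    rw [Nat.primeFactors_mul hℓp.ne_zero (fun hm ↦ h.1.ne_zero (by rw [hm, mul_zero])), Finset.mem_union,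
      hℓp.primeFactors, Finset.mem_singleton] at hr
    rcases hr with rfl | hr
    · have hq : q = v₀ := HeightOneSpectrum.ext (by rw [asIdeal_eq_span_of_mem hℓp hℓP hrq, asIdeal_eq_span_of_mem hℓp hℓP hv₀])
      rw [hq]; exact hv
    · exact hvq q ⟨r, hr, hrq⟩
  · exact fun r hr ↦ (kolyvaginLevel_trivial_sylvesterPair hω h2 hp hp3 κ hκ hNA b₀).1 r ((hKol r).mp hr)
  · exact fun r hr ↦ (kolyvaginLevel_trivial_sylvesterPair hω h2 hp hp3 κ hκ hNA b₀).2 r ((hKol r).mp hr)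

end Summit.BirchSwinnertonDyer.BirchSwinnertonDyer.Theorems.SylvesterTwoCMFlip

end
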